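import Literature.Analysis.Complex.ArcGreenEstimates
import Literature.Analysis.Complex.SymmetricRiemannMap
import Literature.Analysis.Complex.SchwarzReflection
import Mathlib.Analysis.Complex.OperatorNorm
import HarnessLib

/-!
# The Green function of the complement of a Jordan arc: logarithms, asymptotics, gradient

Continuation of `ArcInversion` / `ArcGreenEstimates` for the Green function `g = arcGreen e`
of `ℂ ∖ L`, `L` a Jordan arc with initial point `a = e 0` (`g = -log ‖Φ‖` off `L`,
`Φ = arcGreenMap e` zero-free holomorphic with values in the punctured disc):

* `exists_log_arcGreenMap` — on a hole-free open `G ⊆ ℂ ∖ L` (`Complex.isExactOn_of_compl`),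
  `Φ = exp ∘ Λ` with `Λ` holomorphic and `g = -re Λ`; in particular on discs
  (`exists_log_arcGreenMap_ball`);
* `tendsto_arcGreen_sub_log` — **asymptotics at infinity**:
  `g(w) - log ‖w - a‖ → -log ‖φ'(0)‖` (so `‖φ'(0)‖` is the reciprocal capacity of `L`), from
  `φ(ζ)/ζ → φ'(0)` at `ζ = (w - a)⁻¹ → 0`; and `tendsto_arcGreen_conj_sub` — the reflected
  difference `g(w̄) - g(w) → 0` at infinity;
* `exists_hasFDerivAt_arcGreen` — **gradient bound** `‖∇g(w)‖ ≤ 2 g(w)/d` when `B(w, d) ⊆ ℂ ∖ L`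
  (Schwarz–Pick, `Complex.norm_deriv_le_two_mul_im_div`, for the `ℍ`-valued `-iΛ`), and the
  resulting Lipschitz bound along segments (`abs_arcGreen_sub_le_of_segment`).
-/

noncomputable section

open Set Filter Metric Topology Function Complex Bornology
open scoped unitInterval ComplexConjugate

namespace Literature.Analysis.Complex

variable {L : Set ℂ} (e : I ≃ₜ L)

/-! ### Holomorphic logarithms of `Φ` -/

/-- **Logarithms of `Φ` on hole-free domains off the arc**: if `G ⊆ ℂ ∖ L` is open,
preconnected and every component of `ℂ ∖ G` is unbounded, there is a holomorphic `Λ` on `G`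
with `Φ = exp ∘ Λ`, hence `g = -re Λ`, on `G`. [folklore] -/
theorem exists_log_arcGreenMap {G : Set ℂ} (hG : IsOpen G) (hGc : IsPreconnected G)
    (hGh : ∀ y ∈ Gᶜ, ¬ IsBounded (connectedComponentIn Gᶜ y)) (hGL : G ⊆ Lᶜ) :
    ∃ Λ : ℂ → ℂ, DifferentiableOn ℂ Λ G ∧ (∀ w ∈ G, arcGreenMap e w = exp (Λ w)) ∧
      ∀ w ∈ G, arcGreen e w = -(Λ w).re := by
  have hd : DifferentiableOn ℂ (arcGreenMap e) G := (differentiableOn_arcGreenMap e).mono hGL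
  have hne : ∀ w ∈ G, arcGreenMap e w ≠ 0 := fun w hw ↦
    norm_pos_iff.1 (norm_arcGreenMap_mem e (hGL hw)).1
  obtain ⟨Λ, hΛd, hΛ⟩ := Complex.exists_eq_exp_of_forall_isExactOn hG hGc
    (fun f hf ↦ Complex.isExactOn_of_compl hG hGc hGh hf) hd hne
  refine ⟨Λ, hΛd, hΛ, fun w hw ↦ ?_⟩
  rw [arcGreen_of_notMem e (hGL hw), hΛ w hw, Complex.norm_exp, Real.log_exp]

/-- Logarithms of `Φ` on discs off the arc. [folklore] -/
theorem exists_log_arcGreenMap_ball {c : ℂ} {r : ℝ} (hcr : ball c r ⊆ Lᶜ) :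
    ∃ Λ : ℂ → ℂ, DifferentiableOn ℂ Λ (ball c r) ∧ (∀ w ∈ ball c r, arcGreenMap e w = exp (Λ w)) ∧
      ∀ w ∈ ball c r, arcGreen e w = -(Λ w).re := by
  have hd : DifferentiableOn ℂ (arcGreenMap e) (ball c r) := (differentiableOn_arcGreenMap e).mono hcr
  have hne : ∀ w ∈ ball c r, arcGreenMap e w ≠ 0 := fun w hw ↦
    norm_pos_iff.1 (norm_arcGreenMap_mem e (hcr hw)).1
  obtain ⟨Λ, hΛd, hΛ⟩ := Complex.exists_eq_exp_of_forall_isExactOn isOpen_ball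
    (convex_ball c r).isPreconnected (fun f hf ↦ hf.isExactOn_ball) hd hne
  refine ⟨Λ, hΛd, hΛ, fun w hw ↦ ?_⟩
  rw [arcGreen_of_notMem e (hcr hw), hΛ w hw, Complex.norm_exp, Real.log_exp]

/-! ### Asymptotics at infinity -/

/-- Translation preserves the cobounded filter. [folklore] -/
theorem tendsto_sub_const_cobounded (a : ℂ) : Tendsto (fun w : ℂ ↦ w - a) (cobounded ℂ) (cobounded ℂ) := by
  rw [← tendsto_norm_atTop_iff_cobounded]
  have h : Tendsto (fun w : ℂ ↦ ‖w‖ + -‖a‖) (cobounded ℂ) atTop :=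
    tendsto_atTop_add_const_right _ (-‖a‖) tendsto_norm_cobounded_atTop
  refine tendsto_atTop_mono (fun w ↦ ?_) h
  linarith [norm_sub_norm_le w a]

/-- Complex conjugation preserves the cobounded filter. [folklore] -/
theorem tendsto_conj_cobounded : Tendsto (starRingEnd ℂ) (cobounded ℂ) (cobounded ℂ) := by
  rw [← tendsto_norm_atTop_iff_cobounded]
  simpa using tendsto_norm_cobounded_atTop (E := ℂ)

/-- The inversion `w ↦ (w - a)⁻¹` tends to `0` within the nonzero points at infinity. [folklore] -/
theorem tendsto_inv_sub_cobounded (a : ℂ) :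
    Tendsto (fun w : ℂ ↦ (w - a)⁻¹) (cobounded ℂ) (𝓝[≠] 0) :=
  tendsto_inv₀_cobounded'.comp (tendsto_sub_const_cobounded a)

/-- **Asymptotics of the Green function at infinity**:
`g(w) - log ‖w - a‖ → -log ‖φ'(0)‖` (from `φ(ζ)/ζ → φ'(0)`, `ζ = (w - a)⁻¹ → 0`). [folklore] -/
theorem tendsto_arcGreen_sub_log :
    Tendsto (fun w ↦ arcGreen e w - Real.log ‖w - ((e 0 : L) : ℂ)‖) (cobounded ℂ)
      (𝓝 (-Real.log ‖deriv (arcRiemannMap e) 0‖)) := by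
  set a : ℂ := ((e 0 : L) : ℂ) with ha
  obtain ⟨hφd, -, h0, hder, -⟩ := arcRiemannMap_spec e
  have hopen := isOpen_arcInv (a := a) (isCompact_arc e)
  have hφ0 : HasDerivAt (arcRiemannMap e) (deriv (arcRiemannMap e) 0) 0 :=
    (hφd.differentiableAt (hopen.mem_nhds zero_mem_arcInv)).hasDerivAt
  have hd0 : deriv (arcRiemannMap e) 0 ≠ 0 := hder 0 zero_mem_arcInv
  -- `ζ⁻¹ φ(ζ) → φ'(0)` as `ζ → 0`, `ζ ≠ 0`
  have h1 : Tendsto (fun ζ : ℂ ↦ ζ⁻¹ * arcRiemannMap e ζ) (𝓝[≠] 0) (𝓝 (deriv (arcRiemannMap e) 0)) := by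
    have := hφ0.tendsto_slope_zero
    simpa [h0] using this
  -- compose with the inversion
  have h2 : Tendsto (fun w : ℂ ↦ (w - a) * arcRiemannMap e ((w - a)⁻¹)) (cobounded ℂ)
      (𝓝 (deriv (arcRiemannMap e) 0)) := by
    have := h1.comp (tendsto_inv_sub_cobounded a)
    refine this.congr fun w ↦ ?_
    simp [Function.comp]
  -- take `-log ‖·‖`
  have h3 : Tendsto (fun w : ℂ ↦ -Real.log ‖(w - a) * arcRiemannMap e ((w - a)⁻¹)‖) (cobounded ℂ)
      (𝓝 (-Real.log ‖deriv (arcRiemannMap e) 0‖)) :=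
    ((Real.continuousAt_log (norm_ne_zero_iff.2 hd0)).tendsto.comp (h2.norm)).neg
  refine h3.congr' ?_
  have hev : ∀ᶠ w in cobounded ℂ, w ∉ L := by
    rw [cobounded_eq_cocompact]
    exact (isCompact_arc e).compl_mem_cocompact
  have hev' : ∀ᶠ w in cobounded ℂ, w - a ≠ 0 := by
    filter_upwards [hev] with w hw h
    exact hw (sub_eq_zero.1 h ▸ (e 0).2)
  filter_upwards [hev, hev'] with w hw hwa
  have hpos : 0 < ‖arcRiemannMap e (w - a)⁻¹‖ := (norm_arcGreenMap_mem e hw).1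
  rw [arcGreen_of_notMem e hw, arcGreenMap, norm_mul, Real.log_mul (norm_ne_zero_iff.2 hwa) hpos.ne']
  ring

/-- The ratio `‖w̄ - a‖/‖w - a‖` tends to `1` at infinity. [folklore] -/
theorem tendsto_norm_conj_sub_div (a : ℂ) :
    Tendsto (fun w : ℂ ↦ ‖conj w - a‖ / ‖w - a‖) (cobounded ℂ) (𝓝 1) := by
  -- `|‖w̄ - a‖ - ‖w - a‖| ≤ ‖a - ā‖`, and `‖w - a‖ → ∞`
  have hbd : ∀ w : ℂ, |‖conj w - a‖ - ‖w - a‖| ≤ ‖conj a - a‖ := fun w ↦ by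
    have h1 : ‖w - a‖ = ‖conj w - conj a‖ := by rw [← map_sub, Complex.norm_conj]
    rw [h1]
    refine (abs_norm_sub_norm_le _ _).trans ?_
    rw [show conj w - a - (conj w - conj a) = conj a - a by ring]
  have hden : Tendsto (fun w : ℂ ↦ ‖w - a‖) (cobounded ℂ) atTop :=
    tendsto_norm_atTop_iff_cobounded.2 (tendsto_sub_const_cobounded a)
  have hquot : Tendsto (fun w : ℂ ↦ (‖conj w - a‖ - ‖w - a‖) / ‖w - a‖) (cobounded ℂ) (𝓝 0) := by
    refine squeeze_zero_norm (fun w ↦ ?_) ((tendsto_const_nhds (x := ‖conj a - a‖)).div_atTop hden)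
    rw [Real.norm_eq_abs, abs_div, abs_of_nonneg (norm_nonneg (w - a))]
    exact div_le_div_of_nonneg_right (hbd w) (norm_nonneg _)
  have heq : ∀ᶠ w in cobounded ℂ, ‖conj w - a‖ / ‖w - a‖ = 1 + (‖conj w - a‖ - ‖w - a‖) / ‖w - a‖ := by
    filter_upwards [hden.eventually_gt_atTop 0] with w hw
    field_simp
    ring
  rw [tendsto_congr' heq]
  simpa using tendsto_const_nhds.add hquot

/-- **The reflected difference of the Green function vanishes at infinity**:
`g(w̄) - g(w) → 0` as `w → ∞`. [folklore] -/
theorem tendsto_arcGreen_conj_sub :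
    Tendsto (fun w ↦ arcGreen e (conj w) - arcGreen e w) (cobounded ℂ) (𝓝 0) := by
  set a : ℂ := ((e 0 : L) : ℂ) with ha
  set ℓ : ℝ := -Real.log ‖deriv (arcRiemannMap e) 0‖ with hℓ
  have h1 := tendsto_arcGreen_sub_log e
  have h2 : Tendsto (fun w ↦ arcGreen e (conj w) - Real.log ‖conj w - a‖) (cobounded ℂ) (𝓝 ℓ) :=
    h1.comp tendsto_conj_cobounded
  have h3 : Tendsto (fun w : ℂ ↦ Real.log (‖conj w - a‖ / ‖w - a‖)) (cobounded ℂ) (𝓝 0) := by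
    have := (Real.continuousAt_log one_ne_zero).tendsto.comp (tendsto_norm_conj_sub_div a)
    rw [Real.log_one] at this
    exact this
  have hsum := (h2.sub h1).add h3
  rw [sub_self, zero_add] at hsum
  refine hsum.congr' ?_
  have hden : Tendsto (fun w : ℂ ↦ ‖w - a‖) (cobounded ℂ) atTop :=
    tendsto_norm_atTop_iff_cobounded.2 (tendsto_sub_const_cobounded a)
  have hnum : Tendsto (fun w : ℂ ↦ ‖conj w - a‖) (cobounded ℂ) atTop :=
    tendsto_norm_atTop_iff_cobounded.2 ((tendsto_sub_const_cobounded a).comp tendsto_conj_cobounded)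
  filter_upwards [hden.eventually_gt_atTop 0, hnum.eventually_gt_atTop 0] with w hw hw'
  rw [Real.log_div hw'.ne' hw.ne']
  ring

/-! ### The gradient bound -/

/-- **Gradient bound for the Green function**: if `B(w, d) ⊆ ℂ ∖ L` then `g` is (really)
differentiable at `w` with `‖∇g(w)‖ ≤ 2 g(w)/d` — Schwarz–Pick for the `ℍ`-valued holomorphic
`-iΛ`, `Λ` a logarithm of `Φ` on the disc (`g = -re Λ = im (-iΛ)`). [folklore] -/
theorem exists_hasFDerivAt_arcGreen {w : ℂ} {d : ℝ} (hd : 0 < d) (hball : ball w d ⊆ Lᶜ) :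
    ∃ g' : ℂ →L[ℝ] ℝ, HasFDerivAt (arcGreen e) g' w ∧ ‖g'‖ ≤ 2 * arcGreen e w / d := by
  obtain ⟨Λ, hΛd, -, hΛg⟩ := exists_log_arcGreenMap_ball e hball
  -- the `ℍ`-valued map `-iΛ`
  set G : ℂ → ℂ := fun z ↦ -Complex.I * Λ z with hG
  have hGd : DifferentiableOn ℂ G (ball w d) := hΛd.const_mul _
  have hGim : ∀ z ∈ ball w d, (G z).im = arcGreen e z := fun z hz ↦ by
    rw [hΛg z hz, hG]
    simp
  have hGpos : ∀ z ∈ ball w d, 0 < (G z).im := fun z hz ↦ by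
    rw [hGim z hz]
    exact arcGreen_pos e (hball hz)
  have hSP := Complex.norm_deriv_le_two_mul_im_div hd hGd hGpos
  rw [hGim w (mem_ball_self hd)] at hSP
  have hΛw : HasDerivAt Λ (deriv Λ w) w := (hΛd.differentiableAt (ball_mem_nhds w hd)).hasDerivAt
  have hGw : deriv G w = -Complex.I * deriv Λ w := by
    rw [hG, (hΛw.const_mul (-Complex.I)).deriv]
  have hnorm : ‖deriv Λ w‖ ≤ 2 * arcGreen e w / d := by
    have : ‖deriv G w‖ = ‖deriv Λ w‖ := by rw [hGw, norm_mul, norm_neg, Complex.norm_I, one_mul]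
    rwa [this] at hSP
  -- the real derivative of `g = -re Λ`
  set ℓ : ℂ →L[ℂ] ℂ := ContinuousLinearMap.smulRight (1 : ℂ →L[ℂ] ℂ) (deriv Λ w) with hℓ
  have hΛf : HasFDerivAt Λ (ℓ.restrictScalars ℝ) w := hΛw.hasFDerivAt.restrictScalars ℝ
  set g' : ℂ →L[ℝ] ℝ := -(Complex.reCLM.comp (ℓ.restrictScalars ℝ)) with hg'
  refine ⟨g', ?_, ?_⟩
  · have h1 : HasFDerivAt (fun z ↦ -(Λ z).re) g' w := by
      rw [hg']
      exact (Complex.reCLM.hasFDerivAt.comp w hΛf).neg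
    refine h1.congr_of_eventuallyEq ?_
    filter_upwards [ball_mem_nhds w hd] with z hz
    exact hΛg z hz
  · have hℓn : ‖ℓ.restrictScalars ℝ‖ ≤ ‖deriv Λ w‖ := by
      refine ContinuousLinearMap.opNorm_le_bound _ (norm_nonneg _) fun v ↦ ?_
      rw [ContinuousLinearMap.coe_restrictScalars', hℓ, ContinuousLinearMap.smulRight_apply]
      simp [mul_comm]
    calc ‖g'‖ = ‖Complex.reCLM.comp (ℓ.restrictScalars ℝ)‖ := by rw [hg', norm_neg]
      _ ≤ ‖Complex.reCLM‖ * ‖ℓ.restrictScalars ℝ‖ := ContinuousLinearMap.opNorm_comp_le _ _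
      _ ≤ 1 * ‖deriv Λ w‖ := by
          gcongr
          exact (Complex.reCLM_norm).le
      _ ≤ 2 * arcGreen e w / d := by rw [one_mul]; exact hnorm

/-- **Lipschitz bound along a segment off the arc**: if every point of `[p, p']` is the centre
of a disc `B(·, d) ⊆ ℂ ∖ L` and `g ≤ M` on the segment, then
`|g(p') - g(p)| ≤ (2M/d) ‖p' - p‖`. [folklore] -/
theorem abs_arcGreen_sub_le_of_segment {p p' : ℂ} {d M : ℝ} (hd : 0 < d)
    (hseg : ∀ z ∈ segment ℝ p p', ball z d ⊆ Lᶜ) (hM : ∀ z ∈ segment ℝ p p', arcGreen e z ≤ M) :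
    |arcGreen e p' - arcGreen e p| ≤ 2 * M / d * ‖p' - p‖ := by
  have hderiv : ∀ z ∈ segment ℝ p p', ∃ g' : ℂ →L[ℝ] ℝ, HasFDerivAt (arcGreen e) g' z ∧ ‖g'‖ ≤ 2 * M / d := by
    intro z hz
    obtain ⟨g', hg', hle⟩ := exists_hasFDerivAt_arcGreen e hd (hseg z hz)
    refine ⟨g', hg', hle.trans ?_⟩
    exact div_le_div_of_nonneg_right (by linarith [hM z hz]) hd.le
  choose! g' hg' hle using hderiv
  have h := (convex_segment p p').norm_image_sub_le_of_norm_hasFDerivWithin_le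
    (fun z hz ↦ (hg' z hz).hasFDerivWithinAt) hle (left_mem_segment ℝ p p') (right_mem_segment ℝ p p')
  rwa [Real.norm_eq_abs] at h

end Literature.Analysis.Complex
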